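import Summits.Ventures.CertifiedQuantumChemistry.Rows.TableDistanceLipschitz
import Summits.Ventures.CertifiedQuantumChemistry.Rows.LevelShiftTempleRows
import Summits.Ventures.CertifiedQuantumChemistry.Rows.GapCertificateCodimOne
import HarnessLib

/-!
# Ventures/CertifiedQuantumChemistry — Rows/RotatedFrameTempleRow.lean: the «M3 × M5» DEVICE ROW, composed once and for all —
# a Temple LOWER row certified on a ROUNDED EXACTLY-ROTATED sibling `F″` transports to the CENSUS key `F`, with the β leg
# taken from a LEVEL-SHIFT row ON `F` («no new β leg»), all UNCONDITIONAL after `Rows/TableDistanceLipschitz.lean` ((E2) proved)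

HONEST FRAMING (verbatim): certified bounds for a stated model Hamiltonian in a stated basis; not a
claim about the real molecule or material beyond that model. This file certifies NO number: it composes, for
EVERY `k`, every model `F`, every exact orbital rotation `u` (`uᵀu = 1` over ℚ), every derived table `F″` and
every rational `ε ≥ tableDist (rotate u F) F″`, the kernel chain a «STEP-2» row of the wave-4 LINE #1 instantiates
(director-chem P14 «STEP-2-A HYBRID»; chem-lead A397/A399; critic l.6218): 

* §1 `gapCertificate_of_rotatedFrame_levelShift_thresholds` — the β leg ON `F″` from the certified level-shift row
  ON `F` (rows #321 / #322 class): `LowerRow (F + λ·W) a b ℓ`, `rotate u W = W` (block-diagonal frame), `tableDist (rotate u F) F″ ≤ ε`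
  ⇒ `GapCertificate F″ a b (ℓ − ε − λ·(Σ_{T_α} w + Σ_{T_β} w − δ − μ))` (`lowerRow_levelShift_of_exactRotation_round'` +
  `gapCertificate_of_lowerRow_levelShift_thresholds`);
* §2 `lowerRow_of_rotatedFrame_temple` — a Temple certificate ON `F″` (explicit vector, exact moments w.r.t. `Ĥ_{F″}`, gap level `β″`)
  and `GapCertificate F″ a b β″` give `LowerRow F a b (lo − ε)` ON THE CENSUS KEY (`lowerRow_of_temple` + `lowerRow_of_exactRotation_round'`);
  `upperRow_of_rotatedFrame_witness` (the same vector's Rayleigh quotient, `+ ε`); `bracket_of_rotatedFrame_temple_witness`;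
* §3 `lowerRow_of_rotatedFrame_levelShift_temple` — §1 ∘ §2 in one statement: the hypotheses are exactly (i) the β-leg node's row on
  `F + λ·W`, (ii) `u` exact + `W` `u`-invariant, (iii) `tableDist (rotate u F) F″ ≤ ε`, (iv) `F″` symmetric, (v) the Temple witness on
  `F″` against `β″ = ℓ − ε − λ·(…)`; conclusion `LowerRow F a b (lo − ε)`.

WHAT THIS IS NOT: not a certificate; not a row; no census move; no new definition (theorems only, standard axioms);
the identification of `F`, `F″`, `u` with deposited files and the truth of the moment / leg / distance claims at them are the
readers' (reader-side), exactly as for every OPAQUE (k > 16) cell. Typed by chem-type-07 (B8-1 slot 07, gen 13).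

References: T. Helgaker, P. Jørgensen, J. Olsen (2000) eq. (3.2.1) (orbital rotations); W. Thirring, *Quantum Mathematical
Physics* (2002) (3.5.30; 2) (Temple); R. A. Horn, C. R. Johnson (2013) Thm 4.3.1 (Weyl). Tree (REUSED): `Model.IsExactOrbitalRotation`,
`Model.rotate`, `Model.tableDist`, `lowerRow_of_exactRotation_round'`, `upperRow_of_exactRotation_round'`,
`lowerRow_levelShift_of_exactRotation_round'`, `gapCertificate_of_lowerRow_levelShift_thresholds`, `GapCertificate(.mono)`,
`TempleCertificate`, `lowerRow_of_temple`, `upperRow_of_temple_witness`, `Model.diagWeight`, `Model.lincomb`.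
-/

noncomputable section

namespace Summit.Ventures.CertifiedQuantumChemistry

open Matrix Finset
open Literature.MathematicalPhysics.QuantumLattice Literature.MathematicalPhysics.QuantumChemistry

variable {k : ℕ}

/-! ## §1 The β leg on the rounded rotated file from the level-shift row on the census file -/

/-- **GAP LEG ON `F″` FROM THE LEVEL-SHIFT ROW ON `F`** (threshold template of `gapCertificate_of_lowerRow_levelShift_thresholds`):
`u` an exact orbital rotation fixing the weight file `W = diagWeight w μ` (`rotate u W = W`), `tableDist (rotate u F) F″ ≤ ε`, `F″`
symmetric, `λ ≥ 0`, reference sets `T_α` (`|T_α| = a`), `T_β` (`|T_β| = b`) winning their sizes by the margins, and the certified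
`LowerRow (lincomb 1 λ F W) a b ℓ` ON THE CENSUS FILE give `GapCertificate F″ a b (ℓ − ε − λ·(Σ_{T_α} w + Σ_{T_β} w − min(…) − μ))` —
every `(a, b)`-sector eigenvalue of `Ĥ_{F″}` other than `E₀(F″)` lies above that level. [cite: HornJohnson2013, Thm 4.2.6] -/
theorem gapCertificate_of_rotatedFrame_levelShift_thresholds {u : Matrix (Fin k) (Fin k) ℚ}
    (hu : Model.IsExactOrbitalRotation u) {F F'' : Model k} (hF'' : F''.IsSymmetric)
    {a b : ℕ} {lam : ℚ} (hlam : 0 ≤ lam) {w : Fin k → ℚ} {μ : ℚ}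
    (hW : Model.rotate u (Model.diagWeight w μ) = Model.diagWeight w μ)
    {Tα Tβ : Finset (Fin k)} (hTa : Tα.card = a) (hTb : Tβ.card = b) {loα hiα loβ hiβ : ℚ}
    (hloα : ∀ p ∈ Tα, loα ≤ w p) (hhiα : ∀ p ∉ Tα, w p ≤ hiα) (hα : hiα ≤ loα)
    (hloβ : ∀ p ∈ Tβ, loβ ≤ w p) (hhiβ : ∀ p ∉ Tβ, w p ≤ hiβ) (hβ : hiβ ≤ loβ)
    {ℓ ε : ℚ} (hd : Model.tableDist (Model.rotate u F) F'' ≤ ε)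
    (hL : LowerRow (Model.lincomb 1 lam F (Model.diagWeight w μ)) a b ℓ) :
    GapCertificate F'' a b
      (ℓ - ε - lam * (∑ p ∈ Tα, w p + ∑ p ∈ Tβ, w p - min (loα - hiα) (loβ - hiβ) - μ)) :=
  gapCertificate_of_lowerRow_levelShift_thresholds hF'' hlam hTa hTb hloα hhiα hα hloβ hhiβ hβ
    (lowerRow_levelShift_of_exactRotation_round' hu hW hd hL)

/-! ## §2 The Temple row on `F″`, read on the census key -/

/-- **THE DEVICE'S TEMPLE LOWER ROW**: `u` exact, `tableDist (rotate u F) F″ ≤ ε`, `F″` symmetric, a gap leg `GapCertificate F″ a b β″`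
and a Temple certificate `TempleCertificate F″ a b lo β″` (an explicit nonzero `(a, b)`-sector vector with exact moments w.r.t. `Ĥ_{F″}`,
`A < β″·n`, `lo·(β″n − A) ≤ β″A − B`) give `LowerRow F a b (lo − ε)` ON THE CENSUS KEY of `F`:
`E₀(F) = E₀(rotate u F) ≥ E₀(F″) − ε ≥ lo − ε`. [cite: Thirring2002QMP, (3.5.30; 2)] -/
theorem lowerRow_of_rotatedFrame_temple {u : Matrix (Fin k) (Fin k) ℚ} (hu : Model.IsExactOrbitalRotation u)
    {F F'' : Model k} (hF'' : F''.IsSymmetric) {a b : ℕ} {lo β'' ε : ℚ}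
    (hd : Model.tableDist (Model.rotate u F) F'' ≤ ε)
    (hG : GapCertificate F'' a b β'') (hT : TempleCertificate F'' a b lo β'') :
    LowerRow F a b (lo - ε) :=
  lowerRow_of_exactRotation_round' hu hd (lowerRow_of_temple hF'' hG hT)

/-- **THE DEVICE'S RAYLEIGH UPPER ROW**: the same explicit vector's Rayleigh quotient on `F″`, `Re⟨ψ, Ĥ_{F″}ψ⟩ ≤ hi·⟨ψ,ψ⟩`, gives
`UpperRow F a b (hi + ε)` on the census key (`upperRow_of_temple_witness` + `upperRow_of_exactRotation_round'`).
[cite: HelgakerJorgensenOlsen2000, eq. (3.2.1)] -/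
theorem upperRow_of_rotatedFrame_witness {u : Matrix (Fin k) (Fin k) ℚ} (hu : Model.IsExactOrbitalRotation u)
    {F F'' : Model k} (hF'' : F''.IsSymmetric) {a b : ℕ} {hi ε : ℚ}
    (hd : Model.tableDist (Model.rotate u F) F'' ≤ ε) {ψ : Fock (Orb (Fin k))} (hψ : IsInSector a b ψ) (hψ0 : ψ ≠ 0)
    (hup : (star ψ ⬝ᵥ F''.hamiltonian *ᵥ ψ).re ≤ ((hi : ℚ) : ℝ) * (star ψ ⬝ᵥ ψ).re) :
    UpperRow F a b (hi + ε) :=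
  upperRow_of_exactRotation_round' hu hd (upperRow_of_temple_witness hF'' hψ hψ0 hup)

/-- **THE DEVICE'S ONE-VECTOR BRACKET**: Temple below / Rayleigh–Ritz above for ONE explicit vector on `F″`, transported to `F`:
`Bracket F a b (lo − ε) (hi + ε)`. [cite: Thirring2002QMP, (3.5.30; 2)] -/
theorem bracket_of_rotatedFrame_temple_witness {u : Matrix (Fin k) (Fin k) ℚ} (hu : Model.IsExactOrbitalRotation u)
    {F F'' : Model k} (hF'' : F''.IsSymmetric) {a b : ℕ} {lo hi β'' ε : ℚ}
    (hd : Model.tableDist (Model.rotate u F) F'' ≤ ε) (hG : GapCertificate F'' a b β'')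
    {ψ : Fock (Orb (Fin k))} (hψ : IsInSector a b ψ) (hψ0 : ψ ≠ 0)
    (hlt : (star ψ ⬝ᵥ F''.hamiltonian *ᵥ ψ).re < ((β'' : ℚ) : ℝ) * (star ψ ⬝ᵥ ψ).re)
    (hle : ((lo : ℚ) : ℝ) * (((β'' : ℚ) : ℝ) * (star ψ ⬝ᵥ ψ).re - (star ψ ⬝ᵥ F''.hamiltonian *ᵥ ψ).re) ≤
      ((β'' : ℚ) : ℝ) * (star ψ ⬝ᵥ F''.hamiltonian *ᵥ ψ).re -
        (star ψ ⬝ᵥ (F''.hamiltonian * F''.hamiltonian) *ᵥ ψ).re)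
    (hup : (star ψ ⬝ᵥ F''.hamiltonian *ᵥ ψ).re ≤ ((hi : ℚ) : ℝ) * (star ψ ⬝ᵥ ψ).re) :
    Bracket F a b (lo - ε) (hi + ε) :=
  ⟨lowerRow_of_rotatedFrame_temple hu hF'' hd hG ⟨ψ, hψ, hψ0, hlt, hle⟩,
    upperRow_of_rotatedFrame_witness hu hF'' hd hψ hψ0 hup⟩

/-! ## §3 The whole chain in one statement -/

/-- **«M3 × M5» STEP-2 ROW, ALL-IN-ONE**: from (i) the certified β leg `LowerRow (F + λ·W) a b ℓ` ON THE CENSUS FILE (threshold template,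
`W = diagWeight w μ`), (ii) an exact orbital rotation `u` with `rotate u W = W`, (iii) a derived symmetric table `F″` with
`tableDist (rotate u F) F″ ≤ ε`, and (iv) a Temple certificate ON `F″` against the transported level
`β″ = ℓ − ε − λ·(Σ_{T_α} w + Σ_{T_β} w − min(…) − μ)`: `LowerRow F a b (lo − ε)`. This is the exact hypothesis list of a STEP-2 Lean
cell (each item a reader-verified claim on the opaque binders `F`, `F″`, `u`). [cite: Thirring2002QMP, (3.5.30; 2)] -/
theorem lowerRow_of_rotatedFrame_levelShift_temple {u : Matrix (Fin k) (Fin k) ℚ}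
    (hu : Model.IsExactOrbitalRotation u) {F F'' : Model k} (hF'' : F''.IsSymmetric)
    {a b : ℕ} {lam : ℚ} (hlam : 0 ≤ lam) {w : Fin k → ℚ} {μ : ℚ}
    (hW : Model.rotate u (Model.diagWeight w μ) = Model.diagWeight w μ)
    {Tα Tβ : Finset (Fin k)} (hTa : Tα.card = a) (hTb : Tβ.card = b) {loα hiα loβ hiβ : ℚ}
    (hloα : ∀ p ∈ Tα, loα ≤ w p) (hhiα : ∀ p ∉ Tα, w p ≤ hiα) (hα : hiα ≤ loα)
    (hloβ : ∀ p ∈ Tβ, loβ ≤ w p) (hhiβ : ∀ p ∉ Tβ, w p ≤ hiβ) (hβ : hiβ ≤ loβ)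
    {ℓ ε lo : ℚ} (hd : Model.tableDist (Model.rotate u F) F'' ≤ ε)
    (hL : LowerRow (Model.lincomb 1 lam F (Model.diagWeight w μ)) a b ℓ)
    (hT : TempleCertificate F'' a b lo
      (ℓ - ε - lam * (∑ p ∈ Tα, w p + ∑ p ∈ Tβ, w p - min (loα - hiα) (loβ - hiβ) - μ))) :
    LowerRow F a b (lo - ε) :=
  lowerRow_of_rotatedFrame_temple hu hF'' hd
    (gapCertificate_of_rotatedFrame_levelShift_thresholds hu hF'' hlam hW hTa hTb hloα hhiα hα hloβ hhiβ hβ hd hL) hT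

/-- The same chain with the gap level RELAXED to any `β″ ≤ ℓ − ε − λ·(…)` (e.g. the E24 (13,12) template where `λ·(25 + 24 − 1 − 48) = 0` and
the cell states `β″ = ℓ − ε` as a literal; `GapCertificate.mono`). [cite: Thirring2002QMP, (3.5.30; 2)] -/
theorem lowerRow_of_rotatedFrame_levelShift_temple_mono {u : Matrix (Fin k) (Fin k) ℚ}
    (hu : Model.IsExactOrbitalRotation u) {F F'' : Model k} (hF'' : F''.IsSymmetric)
    {a b : ℕ} {lam : ℚ} (hlam : 0 ≤ lam) {w : Fin k → ℚ} {μ : ℚ}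
    (hW : Model.rotate u (Model.diagWeight w μ) = Model.diagWeight w μ)
    {Tα Tβ : Finset (Fin k)} (hTa : Tα.card = a) (hTb : Tβ.card = b) {loα hiα loβ hiβ : ℚ}
    (hloα : ∀ p ∈ Tα, loα ≤ w p) (hhiα : ∀ p ∉ Tα, w p ≤ hiα) (hα : hiα ≤ loα)
    (hloβ : ∀ p ∈ Tβ, loβ ≤ w p) (hhiβ : ∀ p ∉ Tβ, w p ≤ hiβ) (hβ : hiβ ≤ loβ)
    {ℓ ε lo β'' : ℚ} (hd : Model.tableDist (Model.rotate u F) F'' ≤ ε)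
    (hL : LowerRow (Model.lincomb 1 lam F (Model.diagWeight w μ)) a b ℓ)
    (hβ'' : β'' ≤ ℓ - ε - lam * (∑ p ∈ Tα, w p + ∑ p ∈ Tβ, w p - min (loα - hiα) (loβ - hiβ) - μ))
    (hT : TempleCertificate F'' a b lo β'') :
    LowerRow F a b (lo - ε) :=
  lowerRow_of_rotatedFrame_temple hu hF'' hd
    ((gapCertificate_of_rotatedFrame_levelShift_thresholds hu hF'' hlam hW hTa hTb hloα hhiα hα hloβ hhiβ hβ hd hL).mono
      hβ'') hT

end Summit.Ventures.CertifiedQuantumChemistry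

end
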